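/-
Copyright (c) 2026 the pub-hodgecm-mathlib formalisation cell (harness21).  Prover seat hodgecm-mathlib-K2E5-p16 (g6), Track B «K2-LIT»,
#184♮ = hLiu418 = `stmt-HodgeConjecture-24832`; row `K2LiuArchIntertwiningLieEquivariance` = (A) this file + (B) ★ K2Liu-p11 (g2)
(LEAD F0P6-plan (g13) 10:13:40Z (Q1)–(Q3)(F4) ∕ (g14) BATCH #1; K2Liu-p11 (g2) 10:47:31Z «defer (A) to K2E5-p16; keep the closed form NAMED,
`W` explicit, `g ∈ U(J)`, `½ < re s`»).  File (A) `K2LiuArchIntertwiningLieDerivative`, PART 2: THE SWAP LEMMA and its closed form.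
THEOREMS ONLY (no `def`, no `instance`, no notation, no named-fact hypothesis, no `sorry`; no matrix norm in any statement).
-/
import Summits.HodgeConjecture.HodgeConjecture.Theorems.K2LiuArchIntertwiningLieDerivativePrelims   -- ★ (this seat) (A) part 1
import Summits.HodgeConjecture.HodgeConjecture.Theorems.K2LiuArchNormalisingScalar                  -- ★ K2Liu-p11: `archScalarCoeff`, (A∞-R)
import Mathlib.Analysis.Calculus.ParametricIntegral
import HarnessLib

/-!
# Crux `HLiu418`, A∞ organ, (A): the intertwining operator commutes with right Lie derivatives on the scalar-type vector

Cell `hodgecm-mathlib`, crux item hLiu418 = `stmt-HodgeConjecture-24832` (helper lane `--supports`, count-neutral).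

**THE SWAP LEMMA.**  Let `g ∈ U(J) = U(2,2)` (tube frame), `k : ℤ`, `re s > ½` (the half-plane of ABSOLUTE convergence of `M_w(s)`), and let
`γ` be an entrywise-`C¹` matrix curve with `γ 0 = 1` (velocity `γ′`, `γ′` continuous at `0`; `γ_t` need NOT lie in `U(J)`).  Then
`t ↦ M_w(s) f⁰_{s,k}(g γ_t) = ∫_{Herm₂} f⁰_{s,k}(J n(X) g γ_t) dX` is differentiable at `t = 0` with derivative
`M_w(s)(D f⁰_{s,k})(g)`, `(D f⁰_{s,k})(y) = d∕dt|₀ f⁰_{s,k}(y γ_t) = f⁰_{s,k}(y)·((m∕2 − k) τ_y + (m∕2) conj τ_y)`, `m = k − 2s − 2`,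
`τ_y = tr(Δ_y⁻¹ · denom (y γ′(0)) (i1))` (★ p859383's master formula) — `hasDerivAt_archIntertwining_archScalarSection_mul_curve`.
PROOF: dominated differentiation (`hasDerivAt_integral_of_dominated_loc_of_deriv_le`) on the eventual good set of parameters; the majorant is
`C·|det(X + Z_0)|^{−(2σ+2)}` (★ (L-i) uniform resolvent bounds + perturbation, ★ (L-ii) integrability in the `hermOfReal` chart, ★ part 1
pointwise domination) — NO power of `X` is lost, so the abscissa is the absolute-convergence abscissa `σ > ½`.
**THE CLOSED FORM** (`archIntertwining_lieDeriv_archScalarSection_eq`, the (CR-loc) face): if moreover `γ_t ∈ U(J)`, then by ★ (A∞-R)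
`M_w(s) f⁰_{s,k} = c_k(s) f⁰_{−s,k}` on `U(J)` and uniqueness of derivatives,
`M_w(s)(D f⁰_{s,k})(g) = c_k(s) · (D f⁰_{−s,k})(g)` — both sides EXPLICIT (`c_k = archScalarCoeff`).  Instances `γ_t = exp(tW)`, `γ_t = 1 + tW`:
sequel file `K2LiuArchIntertwiningLieDerivativeExp`.
References: [Knapp1986, Ch. VII §§3–4] (intertwining operators commute with the `𝔤`-action on the absolutely convergent range);
[Shimura1997, §16.4]; [Shimura1982, §1].
HONEST LABEL: HC_CM is proved only modulo the 7 printed citations (2 remaining named inputs: hLiu418 = stmt-HodgeConjecture-24832,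
h413 = stmt-HodgeConjecture-24833) until rung 0 closes; count-neutral helper, closes no socket.
-/

set_option autoImplicit false
set_option linter.dupNamespace false

noncomputable section

open Complex Matrix MeasureTheory Filter NormedSpace
open scoped ComplexConjugate ComplexOrder Topology

namespace Summit.HodgeConjecture.HodgeConjecture.Cruxes.HLiu418.K2LiuArchIntertwiningLieDerivative

open Literature.NumberTheory.ModularForms.SiegelUpperHalfSpace (num denom moeb num_def denom_def moeb_def moeb_mul_denom)
open Summit.HodgeConjecture.HodgeConjecture.Cruxes.HLiu418.K2LiuHermTwoGammaDefs
open Summit.HodgeConjecture.HodgeConjecture.Cruxes.HLiu418.K2LiuHermitianTubeCocycle (mul_mem_UJ isUnit_det_denom posDef_im_moeb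
  posDef_im_I_smul_one isHermitian_re re_add_I_smul_im)
open Summit.HodgeConjecture.HodgeConjecture.Cruxes.HLiu418.K2LiuArchInducedTubeDefs
open Summit.HodgeConjecture.HodgeConjecture.Cruxes.HLiu418.K2LiuArchInducedTubeSection (denom_J_mul_transl)
open Summit.HodgeConjecture.HodgeConjecture.Cruxes.HLiu418.K2LiuArchScalarSectionCurveDerivative
open Summit.HodgeConjecture.HodgeConjecture.Cruxes.HLiu418.K2LiuArchIntertwiningMajorant
open Summit.HodgeConjecture.HodgeConjecture.Cruxes.HLiu418.K2LiuHermTwoResolventBounds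
open Summit.HodgeConjecture.HodgeConjecture.Cruxes.HLiu418.K2LiuArchIntertwiningLieDerivativePrelims
open Summit.HodgeConjecture.HodgeConjecture.Cruxes.HLiu418.K2LiuArchNormalisingScalar (archScalarCoeff archIntertwining_eq_archScalarCoeff_mul)

/-! ## §1  The swap lemma (integrability of the derivative integrand and the derivative of `M_w f⁰(g γ_t)` at `t = 0`) -/

/-- An entrywise differentiable matrix curve is continuous (product topology). [folklore] -/
theorem continuous_of_entry_hasDerivAt {m : Type*} {γ γ' : ℝ → Matrix m m ℂ} (hγ : ∀ t i j, HasDerivAt (fun t => γ t i j) (γ' t i j) t) :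
    Continuous γ :=
  continuous_pi fun i => continuous_pi fun j => continuous_iff_continuousAt.2 fun t => (hγ t i j).continuousAt

/-- **THE SWAP LEMMA, raw form** (`re s > ½`, `g ∈ U(J)`, `γ` entrywise `C¹` near `0` with `γ 0 = 1`): the derivative integrand
`r ↦ (D f⁰_{s,k})(J n(hermOfReal r) g)` is integrable AND `t ↦ M_w(s) f⁰_{s,k}(g γ_t)` has derivative `∫ r, (D f⁰_{s,k})(J n(hermOfReal r) g)` at `0`.
[Knapp1986, Ch. VII §3; Shimura1997, §16.4] -/
theorem integrable_and_hasDerivAt_archIntertwining (k : ℤ) {s : ℂ} (hs : 1 / 2 < s.re)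
    {g : Matrix (Fin 2 ⊕ Fin 2) (Fin 2 ⊕ Fin 2) ℂ} (hg : gᴴ * Matrix.J (Fin 2) ℂ * g = Matrix.J (Fin 2) ℂ)
    {γ γ' : ℝ → Matrix (Fin 2 ⊕ Fin 2) (Fin 2 ⊕ Fin 2) ℂ} (hγ0 : γ 0 = 1)
    (hγ : ∀ t i j, HasDerivAt (fun t => γ t i j) (γ' t i j) t) (hγ' : ∀ i j, ContinuousAt (fun t => γ' t i j) 0) :
    Integrable (fun r : Fin 2 → Fin 2 → ℝ =>
        archScalarSection k s (Matrix.J (Fin 2) ℂ * fromBlocks 1 (hermOfReal r) 0 1 * (g * γ 0)) *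
          ((((k : ℂ) - 2 * s - 2) / 2 - k) *
              ((denom (Matrix.J (Fin 2) ℂ * fromBlocks 1 (hermOfReal r) 0 1 * (g * γ 0)) (I • (1 : Matrix (Fin 2) (Fin 2) ℂ)))⁻¹ *
                denom (Matrix.J (Fin 2) ℂ * fromBlocks 1 (hermOfReal r) 0 1 * (g * γ' 0)) (I • (1 : Matrix (Fin 2) (Fin 2) ℂ))).trace +
            ((k : ℂ) - 2 * s - 2) / 2 *
              conj ((denom (Matrix.J (Fin 2) ℂ * fromBlocks 1 (hermOfReal r) 0 1 * (g * γ 0)) (I • (1 : Matrix (Fin 2) (Fin 2) ℂ)))⁻¹ *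
                denom (Matrix.J (Fin 2) ℂ * fromBlocks 1 (hermOfReal r) 0 1 * (g * γ' 0)) (I • (1 : Matrix (Fin 2) (Fin 2) ℂ))).trace)) ∧
      HasDerivAt (fun t : ℝ => archIntertwining (archScalarSection k s) (g * γ t))
        (∫ r : Fin 2 → Fin 2 → ℝ,
          archScalarSection k s (Matrix.J (Fin 2) ℂ * fromBlocks 1 (hermOfReal r) 0 1 * (g * γ 0)) *
            ((((k : ℂ) - 2 * s - 2) / 2 - k) *
                ((denom (Matrix.J (Fin 2) ℂ * fromBlocks 1 (hermOfReal r) 0 1 * (g * γ 0)) (I • (1 : Matrix (Fin 2) (Fin 2) ℂ)))⁻¹ *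
                  denom (Matrix.J (Fin 2) ℂ * fromBlocks 1 (hermOfReal r) 0 1 * (g * γ' 0)) (I • (1 : Matrix (Fin 2) (Fin 2) ℂ))).trace +
              ((k : ℂ) - 2 * s - 2) / 2 *
                conj ((denom (Matrix.J (Fin 2) ℂ * fromBlocks 1 (hermOfReal r) 0 1 * (g * γ 0)) (I • (1 : Matrix (Fin 2) (Fin 2) ℂ)))⁻¹ *
                  denom (Matrix.J (Fin 2) ℂ * fromBlocks 1 (hermOfReal r) 0 1 * (g * γ' 0)) (I • (1 : Matrix (Fin 2) (Fin 2) ℂ))).trace)) 0 := by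
  -- (0) constants of the scalar kernel
  have ha : 0 ≤ 2 * s.re + 2 := by linarith
  have ha3 : 3 < 2 * s.re + 2 := by linarith
  set c₁ : ℂ := ((k : ℂ) - 2 * s - 2) / 2 - k with hc₁
  set c₂ : ℂ := ((k : ℂ) - 2 * s - 2) / 2 with hc₂
  -- (1) the curve data and its continuity
  have hγc : Continuous γ := continuous_of_entry_hasDerivAt hγ
  have hγ'c : ContinuousAt γ' 0 := continuousAt_pi.2 fun i => continuousAt_pi.2 fun j => hγ' i j
  have hh : Continuous fun t => g * γ t := continuous_const.matrix_mul hγc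
  have hh' : ContinuousAt (fun t => g * γ' t) 0 := continuousAt_const.mul hγ'c
  obtain ⟨d, hd⟩ : ∃ d : ℝ → Matrix (Fin 2) (Fin 2) ℂ, d = fun t => denom (g * γ t) (I • (1 : Matrix (Fin 2) (Fin 2) ℂ)) := ⟨_, rfl⟩
  obtain ⟨Z, hZ⟩ : ∃ Z : ℝ → Matrix (Fin 2) (Fin 2) ℂ, Z = fun t => moeb (g * γ t) (I • (1 : Matrix (Fin 2) (Fin 2) ℂ)) := ⟨_, rfl⟩
  obtain ⟨D', hD'⟩ : ∃ D' : ℝ → Matrix (Fin 2) (Fin 2) ℂ, D' = fun t => denom (g * γ' t) (I • (1 : Matrix (Fin 2) (Fin 2) ℂ)) := ⟨_, rfl⟩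
  obtain ⟨K, hK⟩ : ∃ K : ℝ → Matrix (Fin 2) (Fin 2) ℂ,
      K = fun t => num (g * γ' t) (I • (1 : Matrix (Fin 2) (Fin 2) ℂ)) - Z t * denom (g * γ' t) (I • (1 : Matrix (Fin 2) (Fin 2) ℂ)) :=
    ⟨_, rfl⟩
  have hd_cont : Continuous d := by rw [hd]; exact (continuous_denom _).comp hh
  have hd0u : IsUnit (d 0).det := by
    rw [hd]
    simp only [hγ0, Matrix.mul_one]
    exact isUnit_det_denom hg posDef_im_I_smul_one
  have hd0 : (d 0).det ≠ 0 := hd0u.ne_zero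
  have hdet_cont : ContinuousAt (fun t => (d t).det) 0 := hd_cont.matrix_det.continuousAt
  have hdinv_cont : ContinuousAt (fun t => (d t)⁻¹) 0 := by
    have hA := continuousAt_matrix_inv (d 0) (by rw [Ring.inverse_eq_inv']; exact continuousAt_inv₀ hd0)
    exact ContinuousAt.comp (g := Inv.inv) hA hd_cont.continuousAt
  have hZ_cont : ContinuousAt Z 0 := by
    have hn : Continuous fun t => num (g * γ t) (I • (1 : Matrix (Fin 2) (Fin 2) ℂ)) := (continuous_num _).comp hh
    have h := hn.continuousAt.mul hdinv_cont
    rw [hZ]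
    simp only [moeb_def, hd] at h ⊢
    exact h
  have hD'_cont : ContinuousAt D' 0 := by rw [hD']; exact (continuous_denom _).continuousAt.comp hh'
  have hK_cont : ContinuousAt K 0 := by
    have hDc : ContinuousAt (fun t => denom (g * γ' t) (I • (1 : Matrix (Fin 2) (Fin 2) ℂ))) 0 :=
      (continuous_denom _).continuousAt.comp hh'
    rw [hK]
    exact ((continuous_num _).continuousAt.comp hh').sub (hZ_cont.mul hDc)
  have hdetγ : ContinuousAt (fun t => (γ t).det) 0 := hγc.matrix_det.continuousAt
  have hdetγ0 : (γ 0).det ≠ 0 := by rw [hγ0, det_one]; exact one_ne_zero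
  -- (2) the tube point `Z 0 = U₀ + iV₀` and the resolvent constants
  set U₀ : Matrix (Fin 2) (Fin 2) ℂ := (2 : ℂ)⁻¹ • (Z 0 + (Z 0)ᴴ) with hU₀
  set V₀ : Matrix (Fin 2) (Fin 2) ℂ := (2 * I)⁻¹ • (Z 0 - (Z 0)ᴴ) with hV₀
  have hU₀h : U₀.IsHermitian := isHermitian_re (Z 0)
  have hV₀p : V₀.PosDef := by
    have h : ((2 * I)⁻¹ • (moeb g (I • (1 : Matrix (Fin 2) (Fin 2) ℂ)) - (moeb g (I • (1 : Matrix (Fin 2) (Fin 2) ℂ)))ᴴ)).PosDef :=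
      posDef_im_moeb hg posDef_im_I_smul_one
    rw [hV₀, hZ]
    simpa only [hγ0, Matrix.mul_one] using h
  have hZ₀ : U₀ + I • V₀ = Z 0 := re_add_I_smul_im (Z 0)
  obtain ⟨c₀, C₁, hc₀, -, hres₀⟩ := exists_resolvent_bound hU₀h hV₀p
  obtain ⟨η, C, hη, hC, hres⟩ := exists_resolvent_perturb hU₀h hV₀p
  -- (3) the eventual constants and the good set
  set δ₀ : ℝ := ‖(d 0).det‖ / 2 with hδ₀
  have hδ₀pos : 0 < δ₀ := by have := norm_pos_iff.mpr hd0; positivity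
  set βd : ℝ := (‖(d 0)⁻¹ 0 0‖ + ‖(d 0)⁻¹ 0 1‖ + ‖(d 0)⁻¹ 1 0‖ + ‖(d 0)⁻¹ 1 1‖) + 1 with hβd
  set βD : ℝ := (‖D' 0 0 0‖ + ‖D' 0 0 1‖ + ‖D' 0 1 0‖ + ‖D' 0 1 1‖) + 1 with hβD
  set βK : ℝ := (‖K 0 0 0‖ + ‖K 0 0 1‖ + ‖K 0 1 0‖ + ‖K 0 1 1‖) + 1 with hβK
  have hgood : ∀ᶠ t in 𝓝 (0 : ℝ), (∀ i j, ‖(Z t - Z 0) i j‖ ≤ η) ∧ δ₀ ≤ ‖(d t).det‖ ∧ (∀ i j, ‖(d t)⁻¹ i j‖ ≤ βd) ∧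
      (∀ i j, ‖D' t i j‖ ≤ βD) ∧ (∀ i j, ‖K t i j‖ ≤ βK) ∧ (1 : ℝ) / 2 ≤ ‖(γ t).det‖ := by
    filter_upwards [eventually_norm_sub_apply_le hZ_cont hη, eventually_half_norm_le hdet_cont hd0,
      eventually_norm_apply_le hdinv_cont, eventually_norm_apply_le hD'_cont, eventually_norm_apply_le hK_cont,
      eventually_half_norm_le hdetγ hdetγ0] with t h1 h2 h3 h4 h5 h6
    refine ⟨h1, h2, h3, h4, h5, ?_⟩
    simpa only [hγ0, det_one, norm_one] using h6
  -- consequences on the good set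
  have hkey : ∀ t : ℝ, ((∀ i j, ‖(Z t - Z 0) i j‖ ≤ η) ∧ δ₀ ≤ ‖(d t).det‖ ∧ (∀ i j, ‖(d t)⁻¹ i j‖ ≤ βd) ∧
      (∀ i j, ‖D' t i j‖ ≤ βD) ∧ (∀ i j, ‖K t i j‖ ≤ βK) ∧ (1 : ℝ) / 2 ≤ ‖(γ t).det‖) →
      IsUnit (d t).det ∧ IsUnit (γ t).det ∧ ∀ X : Matrix (Fin 2) (Fin 2) ℂ, X.IsHermitian →
        ‖(X + Z 0).det‖ ≤ 4 * ‖(X + Z t).det‖ ∧ (∀ i j, ‖(X + Z t)⁻¹ i j‖ ≤ C) ∧ 0 < ‖(X + Z 0).det‖ ∧ IsUnit (X + Z t).det := by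
    intro t ht
    obtain ⟨h1, h2, -, -, -, h6⟩ := ht
    refine ⟨isUnit_iff_ne_zero.mpr (norm_pos_iff.mp (hδ₀pos.trans_le h2)),
      isUnit_iff_ne_zero.mpr (norm_pos_iff.mp (lt_of_lt_of_le (by norm_num) h6)), fun X hX => ?_⟩
    have hE := hres X (Z t - Z 0) hX h1
    have hsum : X + (U₀ + I • V₀) + (Z t - Z 0) = X + Z t := by rw [hZ₀]; abel
    rw [hsum, hZ₀] at hE
    have h0 : 0 < ‖(X + Z 0).det‖ := by
      have h := (hres₀ X hX).1
      rw [hZ₀] at h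
      exact hc₀.trans_le h
    have ht' : 0 < ‖(X + Z t).det‖ := by linarith [hE.1]
    exact ⟨hE.1, hE.2, h0, isUnit_iff_ne_zero.mpr (norm_pos_iff.mp ht')⟩
  -- (4) the integrands and the majorant
  obtain ⟨F, hF⟩ : ∃ F : ℝ → (Fin 2 → Fin 2 → ℝ) → ℂ,
      F = fun t r => archScalarSection k s (Matrix.J (Fin 2) ℂ * fromBlocks 1 (hermOfReal r) 0 1 * (g * γ t)) := ⟨_, rfl⟩
  obtain ⟨F', hF'⟩ : ∃ F' : ℝ → (Fin 2 → Fin 2 → ℝ) → ℂ, F' = fun t r =>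
      archScalarSection k s (Matrix.J (Fin 2) ℂ * fromBlocks 1 (hermOfReal r) 0 1 * (g * γ t)) *
        (c₁ * ((denom (Matrix.J (Fin 2) ℂ * fromBlocks 1 (hermOfReal r) 0 1 * (g * γ t)) (I • (1 : Matrix (Fin 2) (Fin 2) ℂ)))⁻¹ *
                denom (Matrix.J (Fin 2) ℂ * fromBlocks 1 (hermOfReal r) 0 1 * (g * γ' t)) (I • (1 : Matrix (Fin 2) (Fin 2) ℂ))).trace +
          c₂ * conj ((denom (Matrix.J (Fin 2) ℂ * fromBlocks 1 (hermOfReal r) 0 1 * (g * γ t)) (I • (1 : Matrix (Fin 2) (Fin 2) ℂ)))⁻¹ *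
                denom (Matrix.J (Fin 2) ℂ * fromBlocks 1 (hermOfReal r) 0 1 * (g * γ' t)) (I • (1 : Matrix (Fin 2) (Fin 2) ℂ))).trace) :=
    ⟨_, rfl⟩
  obtain ⟨bound, hbound⟩ : ∃ bound : (Fin 2 → Fin 2 → ℝ) → ℝ, bound = fun r =>
      (4 : ℝ) ^ (2 * s.re + 2) * δ₀ ^ (-(2 * s.re + 2)) * ‖(hermOfReal r + Z 0).det‖ ^ (-(2 * s.re + 2)) *
        ((‖c₁‖ + ‖c₂‖) * (2 * (2 * βd * (βD + 2 * C * βK)))) := ⟨_, rfl⟩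
  -- the majorant is integrable
  have hmaj : Integrable (fun r : Fin 2 → Fin 2 → ℝ => ‖(hermOfReal r + Z 0).det‖ ^ (-(2 * s.re + 2))) := by
    have h := integrable_norm_det_hermOfReal_add_rpow_neg hU₀h hV₀p ha3
    rw [hZ₀] at h
    exact h
  have hbound_int : Integrable bound := by
    rw [hbound]
    exact (hmaj.const_mul _).mul_const _
  -- factorisations on the good set
  have hΔ : ∀ t : ℝ, IsUnit (d t).det → ∀ X : Matrix (Fin 2) (Fin 2) ℂ,
      denom (Matrix.J (Fin 2) ℂ * fromBlocks 1 X 0 1 * (g * γ t)) (I • (1 : Matrix (Fin 2) (Fin 2) ℂ)) = (X + Z t) * d t := by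
    intro t ht X
    have h := denom_transl_eq_mul X (h := g * γ t) (by rw [hd] at ht; exact ht)
    rw [hZ, hd]
    exact h
  have hΔ' : ∀ (t : ℝ) (X : Matrix (Fin 2) (Fin 2) ℂ),
      denom (Matrix.J (Fin 2) ℂ * fromBlocks 1 X 0 1 * (g * γ' t)) (I • (1 : Matrix (Fin 2) (Fin 2) ℂ)) =
        num (g * γ' t) (I • (1 : Matrix (Fin 2) (Fin 2) ℂ)) + X * D' t := by
    intro t X
    rw [hD', denom_J_mul_transl]
  have hZne : ∀ t : ℝ, (∀ X : Matrix (Fin 2) (Fin 2) ℂ, X.IsHermitian → IsUnit (X + Z t).det) →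
      ∀ X : Matrix (Fin 2) (Fin 2) ℂ, X.IsHermitian → (X + moeb (g * γ t) (I • (1 : Matrix (Fin 2) (Fin 2) ℂ))).det ≠ 0 := by
    intro t ht X hX
    have h := (ht X hX).ne_zero
    rw [hZ] at h
    exact h
  -- (5) the six hypotheses of dominated differentiation
  have hF_meas : ∀ᶠ t in 𝓝 (0 : ℝ), AEStronglyMeasurable (F t) volume := by
    refine hgood.mono fun t ht => ?_
    obtain ⟨hdt, -, hXt⟩ := hkey t ht
    have hdt' : IsUnit (denom (g * γ t) (I • (1 : Matrix (Fin 2) (Fin 2) ℂ))).det := by rw [hd] at hdt; exact hdt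
    rw [hF]
    exact (continuous_integrand k s hdt' (hZne t fun X hX => (hXt X hX).2.2.2)).aestronglyMeasurable
  have hgood0 := hgood.self_of_nhds
  obtain ⟨hd0u', -, hX0⟩ := hkey 0 hgood0
  have hd0'' : IsUnit (denom (g * γ 0) (I • (1 : Matrix (Fin 2) (Fin 2) ℂ))).det := by rw [hd] at hd0u'; exact hd0u'
  have hF'_meas : AEStronglyMeasurable (F' 0) volume := by
    rw [hF']
    exact (continuous_deriv_integrand k s c₁ c₂ (g * γ' 0) hd0'' (hZne 0 fun X hX => (hX0 X hX).2.2.2)).aestronglyMeasurable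
  have hF_int : Integrable (F 0) volume := by
    have hF0_meas : AEStronglyMeasurable (F 0) volume := by
      rw [hF]
      exact (continuous_integrand k s hd0'' (hZne 0 fun X hX => (hX0 X hX).2.2.2)).aestronglyMeasurable
    refine Integrable.mono' (hmaj.const_mul (‖(d 0).det‖ ^ (-(2 * s.re + 2)))) hF0_meas (Eventually.of_forall fun r => ?_)
    have hX := isHermitian_hermOfReal r
    have hne : (denom (Matrix.J (Fin 2) ℂ * fromBlocks 1 (hermOfReal r) 0 1 * (g * γ 0)) (I • (1 : Matrix (Fin 2) (Fin 2) ℂ))).det ≠ 0 := by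
      rw [hΔ 0 hd0u', det_mul]
      exact mul_ne_zero (hX0 _ hX).2.2.2.ne_zero hd0
    rw [hF]
    simp only
    rw [norm_archScalarSection_eq_two k s hne, hΔ 0 hd0u', det_mul, norm_mul,
      Real.mul_rpow (norm_nonneg _) (norm_nonneg _), mul_comm]
  have h_bound : ∀ᵐ r ∂(volume : Measure (Fin 2 → Fin 2 → ℝ)), ∀ t ∈ {t : ℝ | (∀ i j, ‖(Z t - Z 0) i j‖ ≤ η) ∧ δ₀ ≤ ‖(d t).det‖ ∧
      (∀ i j, ‖(d t)⁻¹ i j‖ ≤ βd) ∧ (∀ i j, ‖D' t i j‖ ≤ βD) ∧ (∀ i j, ‖K t i j‖ ≤ βK) ∧ (1 : ℝ) / 2 ≤ ‖(γ t).det‖},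
      ‖F' t r‖ ≤ bound r := by
    refine Eventually.of_forall fun r t ht => ?_
    obtain ⟨hdt, -, hXt⟩ := hkey t ht
    obtain ⟨-, h2, h3, h4, h5, -⟩ := ht
    have hX := isHermitian_hermOfReal r
    obtain ⟨hdet4, hR, hdet₀, -⟩ := hXt _ hX
    have hK' : ∀ i j, ‖(num (g * γ' t) (I • (1 : Matrix (Fin 2) (Fin 2) ℂ)) - Z t * D' t) i j‖ ≤ βK := by
      intro i j
      have h := h5 i j
      rw [hK] at h
      simpa only [hD'] using h
    rw [hF', hbound]
    simp only
    rw [archScalarSection_apply, hΔ t hdt, hΔ' t, Fintype.card_fin, Nat.cast_ofNat]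
    exact norm_kernel_mul_logDeriv_le k s c₁ c₂ ha hδ₀pos hdet4 hdet₀ h2 hR h3 h4 hK'
  have h_diff : ∀ᵐ r ∂(volume : Measure (Fin 2 → Fin 2 → ℝ)), ∀ t ∈ {t : ℝ | (∀ i j, ‖(Z t - Z 0) i j‖ ≤ η) ∧ δ₀ ≤ ‖(d t).det‖ ∧
      (∀ i j, ‖(d t)⁻¹ i j‖ ≤ βd) ∧ (∀ i j, ‖D' t i j‖ ≤ βD) ∧ (∀ i j, ‖K t i j‖ ≤ βK) ∧ (1 : ℝ) / 2 ≤ ‖(γ t).det‖},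
      HasDerivAt (fun t => F t r) (F' t r) t := by
    refine Eventually.of_forall fun r t ht => ?_
    obtain ⟨hdt, hγt, hXt⟩ := hkey t ht
    have hX := isHermitian_hermOfReal r
    have hx : (denom (Matrix.J (Fin 2) ℂ * fromBlocks 1 (hermOfReal r) 0 1 * g * γ t) (I • (1 : Matrix (Fin 2) (Fin 2) ℂ))).det ≠ 0 := by
      rw [Matrix.mul_assoc, hΔ t hdt, det_mul]
      exact mul_ne_zero (hXt _ hX).2.2.2.ne_zero hdt.ne_zero
    have h := hasDerivAt_archScalarSection_mul_curve_at k s (x := Matrix.J (Fin 2) ℂ * fromBlocks 1 (hermOfReal r) 0 1 * g) hγ hγt hx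
    rw [hF, hF']
    simp only [Matrix.mul_assoc, Fintype.card_fin, Nat.cast_ofNat] at h ⊢
    exact h
  -- (6) dominated differentiation
  have hmain := hasDerivAt_integral_of_dominated_loc_of_deriv_le hgood hF_meas hF_int hF'_meas h_bound hbound_int h_diff
  refine ⟨?_, ?_⟩
  · have h1 := hmain.1
    rw [hF'] at h1
    exact h1
  · have h2 := hmain.2
    rw [hF, hF'] at h2
    exact h2

/-- **THE SWAP LEMMA** (A): for `g ∈ U(2,2)`, `k : ℤ`, `re s > ½` and an entrywise-`C¹` matrix curve `γ` with `γ 0 = 1`, velocity `γ′` continuous at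
`0`,  `d∕dt|₀ M_w(s) f⁰_{s,k}(g γ_t) = M_w(s)(D f⁰_{s,k})(g)` where `(D f⁰_{s,k})(y) = f⁰_{s,k}(y)·((m∕2 − k)τ_y + (m∕2) conj τ_y)`,
`m = k − 2s − 2`, `τ_y = tr((denom y (i1))⁻¹ · denom (y·γ′(0)) (i1))` is the right derivative `d∕dt|₀ f⁰_{s,k}(y γ_t)` (★ p859383).
[Knapp1986, Ch. VII §3; Shimura1997, §16.4] -/
theorem hasDerivAt_archIntertwining_archScalarSection_mul_curve (k : ℤ) {s : ℂ} (hs : 1 / 2 < s.re)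
    {g : Matrix (Fin 2 ⊕ Fin 2) (Fin 2 ⊕ Fin 2) ℂ} (hg : gᴴ * Matrix.J (Fin 2) ℂ * g = Matrix.J (Fin 2) ℂ)
    {γ γ' : ℝ → Matrix (Fin 2 ⊕ Fin 2) (Fin 2 ⊕ Fin 2) ℂ} (hγ0 : γ 0 = 1)
    (hγ : ∀ t i j, HasDerivAt (fun t => γ t i j) (γ' t i j) t) (hγ' : ∀ i j, ContinuousAt (fun t => γ' t i j) 0) :
    HasDerivAt (fun t : ℝ => archIntertwining (archScalarSection k s) (g * γ t))
      (archIntertwining (fun y => archScalarSection k s y *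
          ((((k : ℂ) - 2 * s - 2) / 2 - k) *
              ((denom y (I • (1 : Matrix (Fin 2) (Fin 2) ℂ)))⁻¹ * denom (y * γ' 0) (I • (1 : Matrix (Fin 2) (Fin 2) ℂ))).trace +
            ((k : ℂ) - 2 * s - 2) / 2 *
              conj ((denom y (I • (1 : Matrix (Fin 2) (Fin 2) ℂ)))⁻¹ * denom (y * γ' 0) (I • (1 : Matrix (Fin 2) (Fin 2) ℂ))).trace)) g) 0 := by
  have h := (integrable_and_hasDerivAt_archIntertwining k hs hg hγ0 hγ hγ').2
  simp only [hγ0, Matrix.mul_one] at h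
  rw [archIntertwining_apply]
  simp only [Matrix.mul_assoc] at h ⊢
  exact h

/-- **Integrability of the derivative integrand** `r ↦ (D f⁰_{s,k})(J n(hermOfReal r) g)` (so `M_w(s)(D f⁰_{s,k})(g)` converges absolutely).
[Shimura1982, (1.26)] -/
theorem integrable_lieDeriv_archScalarSection (k : ℤ) {s : ℂ} (hs : 1 / 2 < s.re)
    {g : Matrix (Fin 2 ⊕ Fin 2) (Fin 2 ⊕ Fin 2) ℂ} (hg : gᴴ * Matrix.J (Fin 2) ℂ * g = Matrix.J (Fin 2) ℂ)
    {γ γ' : ℝ → Matrix (Fin 2 ⊕ Fin 2) (Fin 2 ⊕ Fin 2) ℂ} (hγ0 : γ 0 = 1)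
    (hγ : ∀ t i j, HasDerivAt (fun t => γ t i j) (γ' t i j) t) (hγ' : ∀ i j, ContinuousAt (fun t => γ' t i j) 0) :
    Integrable (fun r : Fin 2 → Fin 2 → ℝ =>
      archScalarSection k s (Matrix.J (Fin 2) ℂ * fromBlocks 1 (hermOfReal r) 0 1 * g) *
        ((((k : ℂ) - 2 * s - 2) / 2 - k) *
            ((denom (Matrix.J (Fin 2) ℂ * fromBlocks 1 (hermOfReal r) 0 1 * g) (I • (1 : Matrix (Fin 2) (Fin 2) ℂ)))⁻¹ *
              denom (Matrix.J (Fin 2) ℂ * fromBlocks 1 (hermOfReal r) 0 1 * g * γ' 0) (I • (1 : Matrix (Fin 2) (Fin 2) ℂ))).trace +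
          ((k : ℂ) - 2 * s - 2) / 2 *
            conj ((denom (Matrix.J (Fin 2) ℂ * fromBlocks 1 (hermOfReal r) 0 1 * g) (I • (1 : Matrix (Fin 2) (Fin 2) ℂ)))⁻¹ *
              denom (Matrix.J (Fin 2) ℂ * fromBlocks 1 (hermOfReal r) 0 1 * g * γ' 0) (I • (1 : Matrix (Fin 2) (Fin 2) ℂ))).trace)) := by
  have h := (integrable_and_hasDerivAt_archIntertwining k hs hg hγ0 hγ hγ').1
  simp only [hγ0, Matrix.mul_one] at h
  simp only [Matrix.mul_assoc] at h ⊢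
  exact h

/-- The `deriv` form of the swap lemma. [Knapp1986, Ch. VII §3] -/
theorem deriv_archIntertwining_archScalarSection_mul_curve (k : ℤ) {s : ℂ} (hs : 1 / 2 < s.re)
    {g : Matrix (Fin 2 ⊕ Fin 2) (Fin 2 ⊕ Fin 2) ℂ} (hg : gᴴ * Matrix.J (Fin 2) ℂ * g = Matrix.J (Fin 2) ℂ)
    {γ γ' : ℝ → Matrix (Fin 2 ⊕ Fin 2) (Fin 2 ⊕ Fin 2) ℂ} (hγ0 : γ 0 = 1)
    (hγ : ∀ t i j, HasDerivAt (fun t => γ t i j) (γ' t i j) t) (hγ' : ∀ i j, ContinuousAt (fun t => γ' t i j) 0) :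
    deriv (fun t : ℝ => archIntertwining (archScalarSection k s) (g * γ t)) 0 =
      archIntertwining (fun y => archScalarSection k s y *
          ((((k : ℂ) - 2 * s - 2) / 2 - k) *
              ((denom y (I • (1 : Matrix (Fin 2) (Fin 2) ℂ)))⁻¹ * denom (y * γ' 0) (I • (1 : Matrix (Fin 2) (Fin 2) ℂ))).trace +
            ((k : ℂ) - 2 * s - 2) / 2 *
              conj ((denom y (I • (1 : Matrix (Fin 2) (Fin 2) ℂ)))⁻¹ * denom (y * γ' 0) (I • (1 : Matrix (Fin 2) (Fin 2) ℂ))).trace)) g :=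
  (hasDerivAt_archIntertwining_archScalarSection_mul_curve k hs hg hγ0 hγ hγ').deriv

/-! ## §2  The closed form on `U(J)`-valued curves (the (CR-loc) face) -/

/-- **THE CLOSED FORM `M_w(s)(D f⁰_{s,k})(g) = c_k(s)·(D f⁰_{−s,k})(g)`** for `g ∈ U(2,2)`, `re s > ½`, and a `U(J)`-VALUED entrywise-`C¹`
curve `γ` through `1` (velocity `W = γ′(0)`): the intertwining operator commutes with the right derivative along `γ`, and on `U(J)`
`M_w(s) f⁰_{s,k} = c_k(s)·f⁰_{−s,k}` (★ (A∞-R)), so both sides are EXPLICIT (`c_k = archScalarCoeff`; ★ p859383 at `−s` on the right).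
[Knapp1986, Ch. VII §§3–4; Shimura1997, §16.4] -/
theorem archIntertwining_lieDeriv_archScalarSection_eq (k : ℤ) {s : ℂ} (hs : 1 / 2 < s.re)
    {g : Matrix (Fin 2 ⊕ Fin 2) (Fin 2 ⊕ Fin 2) ℂ} (hg : gᴴ * Matrix.J (Fin 2) ℂ * g = Matrix.J (Fin 2) ℂ)
    {γ γ' : ℝ → Matrix (Fin 2 ⊕ Fin 2) (Fin 2 ⊕ Fin 2) ℂ} (hγ0 : γ 0 = 1)
    (hγ : ∀ t i j, HasDerivAt (fun t => γ t i j) (γ' t i j) t) (hγ' : ∀ i j, ContinuousAt (fun t => γ' t i j) 0)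
    (hγU : ∀ t : ℝ, (γ t)ᴴ * Matrix.J (Fin 2) ℂ * γ t = Matrix.J (Fin 2) ℂ) :
    archIntertwining (fun y => archScalarSection k s y *
          ((((k : ℂ) - 2 * s - 2) / 2 - k) *
              ((denom y (I • (1 : Matrix (Fin 2) (Fin 2) ℂ)))⁻¹ * denom (y * γ' 0) (I • (1 : Matrix (Fin 2) (Fin 2) ℂ))).trace +
            ((k : ℂ) - 2 * s - 2) / 2 *
              conj ((denom y (I • (1 : Matrix (Fin 2) (Fin 2) ℂ)))⁻¹ * denom (y * γ' 0) (I • (1 : Matrix (Fin 2) (Fin 2) ℂ))).trace)) g =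
      archScalarCoeff k s * (archScalarSection k (-s) g *
        ((((k : ℂ) - 2 * (-s) - 2) / 2 - k) *
            ((denom g (I • (1 : Matrix (Fin 2) (Fin 2) ℂ)))⁻¹ * denom (g * γ' 0) (I • (1 : Matrix (Fin 2) (Fin 2) ℂ))).trace +
          ((k : ℂ) - 2 * (-s) - 2) / 2 *
            conj ((denom g (I • (1 : Matrix (Fin 2) (Fin 2) ℂ)))⁻¹ * denom (g * γ' 0) (I • (1 : Matrix (Fin 2) (Fin 2) ℂ))).trace)) := by
  have h1 := hasDerivAt_archIntertwining_archScalarSection_mul_curve k hs hg hγ0 hγ hγ'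
  have hfun : (fun t : ℝ => archIntertwining (archScalarSection k s) (g * γ t)) =
      fun t => archScalarCoeff k s * archScalarSection k (-s) (g * γ t) := by
    funext t
    exact archIntertwining_eq_archScalarCoeff_mul k hs (mul_mem_UJ hg (hγU t))
  rw [hfun] at h1
  have hgd : (denom g (I • (1 : Matrix (Fin 2) (Fin 2) ℂ))).det ≠ 0 := (isUnit_det_denom hg posDef_im_I_smul_one).ne_zero
  have h2 := (hasDerivAt_archScalarSection_mul_curve k (-s) (g := g) (W := γ' 0) hgd hγ0 (fun i j => hγ 0 i j)).const_mul
    (archScalarCoeff k s)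
  simp only [Fintype.card_fin, Nat.cast_ofNat] at h2
  exact h1.unique h2

end Summit.HodgeConjecture.HodgeConjecture.Cruxes.HLiu418.K2LiuArchIntertwiningLieDerivative

end
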